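import Summits.CriticalPhenomena.SAWScalingLimit.Theorems.SAWDevelopingMapHexTightBoundaryReduction
import Mathlib.Analysis.Normed.Module.FiniteDimension
import HarnessLib

/-!
# The boundary atom of the crux `HexTight` lives ON the Jordan curve (stmt-CriticalPhenomena-5423)

Crux `Summit.CriticalPhenomena.SAWScalingLimit.Theses.SAWDevelopingMap.HexTight`, line `reversal-virgin-disc`, seat c2
(`prover-line-stmt-CriticalPhenomena-5423-c2-0`). Companion of seat c1's
`SAWDevelopingMapHexTightBoundaryReduction.lean`, which reduced the boundary regime of Aizenman–Burchard's (H1) to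
per-shell, rate-free tightness of the traversal number on thin shells centred in `Ωᶜ` (`x ∉ Ω`). Here the centre
is moved onto the FRONTIER: it suffices to have per-shell tightness on thin shells `D(x; ρ, R)` (`0 < ρ`,
`4ρ < R ≤ 1`) centred at points `x ∈ frontier Ω` — for a Dobrushin domain, at the points of its Jordan curve.

* `not_hasTraversals_one_of_disjoint` — a shell whose inner closed ball misses `closure Ω` is never traversed by the
  polyline of a SAW of `Ω_δ` (a non-trivial walk runs through vertices of `Ω_δ` along segments in `closure Ω`;
  the trivial walk is a constant curve).
* `boundaryPerShellTight_of_onFrontier` — for an open `Ω` and a boundary shell `D(x; ρ, R)` (`closedBall x R ⊄ Ω`,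
  `64ρ < R ≤ 1`): with `d = infDist x Ωᶜ`, if `8ρ < d` the interior thin shell `D(x; ρ, d/2)` is traversed as often;
  if `d ≤ 8ρ` and `closedBall x ρ` misses `closure Ω` the traversal event is EMPTY; otherwise a point
  `y ∈ closedBall x ρ ∩ closure Ω` is within `9ρ` of `Ωᶜ`, so (`exists_mem_frontier_infDist_compl_eq_dist`) some
  `x'' ∈ frontier Ω` has `dist x x'' ≤ 10ρ`, and the thin shell `D(x''; 11ρ, R - 10ρ)` centred ON the frontier is
  traversed as often (`Curve.HasTraversals.mono`).
* `traversalBound_of_interiorThin_of_onFrontier`, `hexTight_of_interiorThin_of_onFrontier`,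
  `hexTight_of_interiorBound_one_of_onFrontier` — hence (H1) (`λ = 3`, `δ₀ = 1`) and the crux follow from thin INTERIOR
  per-shell tightness (resp. an interior traversal bound with some exponent `> 1`) plus per-shell tightness on thin
  shells centred ON `frontier Ω`.

References: M. Aizenman, A. Burchard, Duke Math. J. 99 (1999) §1.a–b, §3.a [AizenmanBurchardDuke1999];
H. Duminil-Copin, S. Smirnov, Ann. of Math. 175 (2012) §4 [DuminilCopinSmirnov2012].
-/

noncomputable section

open scoped BigOperators Classical
open MeasureTheory Filter Topology Set Metric
open Literature.Probability.LatticeModels Literature.Probability.RandomPlanarGeometry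
  Literature.Probability.RandomPlanarGeometry.SAW

namespace Summit.CriticalPhenomena.SAWScalingLimit.Theorems.HexTight.BoundaryOnFrontier

open Summit.CriticalPhenomena.SAWScalingLimit.Theorems.HexTight.ExponentBootstrap

/-! ### Confinement: a shell whose inner ball misses `closure Ω` is never traversed -/

/-- The polyline of a walk lies in any set containing the image of the first vertex and every dart segment.
(adapted from `Cruxes/HexTight/Disproof.lean`, `range_toCurve_subset_of_darts`, refuter cdisprove gen 2) -/
theorem range_toCurve_subset_of_darts {V : Type*} {S : Set ℂ} (f : V → ℂ) {H : SimpleGraph V} :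
    ∀ {u v : V} (p : H.Walk u v), f u ∈ S →
      (∀ d ∈ p.darts, segment ℝ (f d.fst) (f d.snd) ⊆ S) → Set.range (p.toCurve f) ⊆ S
  | u, _, SimpleGraph.Walk.nil, hu, _ => by
    have : Set.range ((SimpleGraph.Walk.nil : H.Walk u u).toCurve f) = {f u} := by
      simp [SimpleGraph.Walk.toCurve, polyline]
    rw [this]
    exact singleton_subset_iff.2 hu
  | u, _, SimpleGraph.Walk.cons (v := w) h p, _, hd => by
    have hc : Set.range ((SimpleGraph.Walk.cons h p).toCurve f) =
        segment ℝ (f u) (f w) ∪ Set.range (p.toCurve f) := by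
      cases p <;>
        simp [SimpleGraph.Walk.toCurve, polyline, Path.trans_range, Path.range_segment]
    rw [hc]
    have hseg : segment ℝ (f u) (f w) ⊆ S := hd ⟨(u, w), h⟩ (List.mem_cons_self ..)
    refine Set.union_subset hseg (range_toCurve_subset_of_darts f p (hseg (right_mem_segment _ _ _)) ?_)
    exact fun d hd' => hd d (List.mem_cons_of_mem _ hd')

/-- The polyline of a NON-trivial SAW of `Ω_δ` lies in `closure Ω`: its first vertex is a vertex of `Ω_δ` (it carries
an edge), hence has rescaled centre in `Ω`, and every edge segment of `Ω_δ` lies in `closure Ω`. -/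
theorem range_toCurve_subset_closure_of_ne {Ω : Set ℂ} {δ : ℝ} {a b : HexVertex} (hab : a ≠ b)
    (γ : HexDomainSAW Ω δ a b) :
    Set.range (γ.walk.toCurve fun v => (δ : ℂ) * hexCenter v) ⊆ closure Ω := by
  refine range_toCurve_subset_of_darts (fun v => (δ : ℂ) * hexCenter v) γ.walk ?_ ?_
  · -- the first vertex carries an edge of `Ω_δ`
    cases hw : γ.walk with
    | nil => exact absurd rfl hab
    | cons h p =>
      have ha := ((embDomainGraph_adj_iff hexGraph hexCenter).1 h).2.1
      exact subset_closure ((embMeshDomain_subset hexGraph hexCenter Ω δ) ha)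
  · intro d _
    exact ((embMeshGraph_adj_iff hexGraph hexCenter).1 ((embDomainGraph_adj_iff hexGraph hexCenter).1 d.adj).1).2

/-- **A shell whose inner closed ball misses `closure Ω` is not traversed** (not even once, `ρ < R`) by the polyline
of any SAW of `Ω_δ`: a non-trivial walk stays in `closure Ω`, the trivial walk is a constant curve. -/
theorem not_hasTraversals_one_of_disjoint {Ω : Set ℂ} {δ : ℝ} {a b : HexVertex} {x : ℂ} {ρ R : ℝ}
    (hdis : Disjoint (Metric.closedBall x ρ) (closure Ω)) (hρR : ρ < R) (γ : HexDomainSAW Ω δ a b) :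
    ¬ (⟨γ.walk.toCurve fun v => (δ : ℂ) * hexCenter v⟩ : Curve ℂ).HasTraversals 1 x ρ R := by
  rintro ⟨s, t, hst, -⟩
  have h0 := hst 0
  by_cases hab : a = b
  · -- trivial walk: constant curve
    subst hab
    have hnil : γ.walk = SimpleGraph.Walk.nil :=
      SimpleGraph.Walk.eq_nil_iff_nil.2 (SimpleGraph.Walk.isPath_iff_nil.1 γ.isPath)
    have hconst : ∀ u : unitInterval,
        (⟨γ.walk.toCurve fun v => (δ : ℂ) * hexCenter v⟩ : Curve ℂ) u = (δ : ℂ) * hexCenter a := by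
      intro u
      show (γ.walk.toCurve fun v => (δ : ℂ) * hexCenter v) u = _
      rw [hnil]
      simp [SimpleGraph.Walk.toCurve, polyline]
    rcases h0.2 with ⟨h1, h2⟩ | ⟨h1, h2⟩ <;> rw [hconst] at h1 h2 <;> linarith
  · have hrange := range_toCurve_subset_closure_of_ne hab γ
    have hmem : ∀ u : unitInterval,
        (⟨γ.walk.toCurve fun v => (δ : ℂ) * hexCenter v⟩ : Curve ℂ) u ∈ closure Ω :=
      fun u => hrange ⟨u, rfl⟩
    rcases h0.2 with ⟨h1, -⟩ | ⟨-, h1⟩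
    · exact Set.disjoint_left.1 hdis (Metric.mem_closedBall.2 h1) (hmem _)
    · exact Set.disjoint_left.1 hdis (Metric.mem_closedBall.2 h1) (hmem _)

/-! ### Boundary shells reduce to thin shells centred ON the frontier -/

/-- **A frontier point near a boundary shell's inner ball.** If `Ω` is open, `y ∈ closure Ω` with `dist y x ≤ ρ` and
`z ∉ Ω` with `dist x z ≤ 8ρ`, then some `x'' ∈ frontier Ω` has `dist x x'' ≤ 10ρ`. -/
theorem exists_frontier_near {Ω : Set ℂ} (hΩ : IsOpen Ω) {x y z : ℂ} {ρ : ℝ} (hy : y ∈ closure Ω)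
    (hyx : dist y x ≤ ρ) (hz : z ∉ Ω) (hzx : dist x z ≤ 8 * ρ) :
    ∃ x'' ∈ frontier Ω, dist x x'' ≤ 10 * ρ := by
  have hρ : 0 ≤ ρ := dist_nonneg.trans hyx
  rw [closure_eq_interior_union_frontier, hΩ.interior_eq] at hy
  rcases hy with hyΩ | hyfr
  · have hne : Ω ≠ Set.univ := fun h => hz (h ▸ Set.mem_univ z)
    obtain ⟨x'', hx''fr, hx''d⟩ := exists_mem_frontier_infDist_compl_eq_dist hyΩ hne
    refine ⟨x'', hx''fr, ?_⟩
    have h1 : Metric.infDist y Ωᶜ ≤ dist y z := Metric.infDist_le_dist_of_mem (Set.mem_compl hz)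
    have h2 : dist y z ≤ 9 * ρ := by linarith [dist_triangle y x z]
    calc dist x x'' ≤ dist x y + dist y x'' := dist_triangle _ _ _
      _ ≤ ρ + 9 * ρ := by rw [dist_comm x y, ← hx''d]; exact add_le_add hyx (h1.trans h2)
      _ = 10 * ρ := by ring
  · exact ⟨y, hyfr, by rw [dist_comm]; linarith⟩

/-- **Boundary per-shell tightness from interior-thin and ON-FRONTIER-thin per-shell tightness.** Let `Ω` be open.
Suppose the traversal number is tight as `δ → 0` (i) on every thin interior shell (`0 < ρ`, `4ρ < R ≤ 1`,
`closedBall x R ⊆ Ω`) and (ii) on every thin shell centred ON the frontier (`0 < ρ`, `4ρ < R ≤ 1`, `x ∈ frontier Ω`).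
Then it is tight on every boundary shell `D(x; ρ, R)` with `64ρ < R ≤ 1`, `closedBall x R ⊄ Ω` (three cases: deep
centre → interior thin shell `D(x; ρ, d/2)`; inner ball off `closure Ω` → empty event; otherwise the thin shell
`D(x''; 11ρ, R - 10ρ)` about a frontier point `x''` with `dist x x'' ≤ 10ρ`). -/
theorem boundaryPerShellTight_of_onFrontier :
    ∀ (Ω : Set ℂ), IsOpen Ω → ∀ (a b : ℝ → HexVertex),
      (∀ (x : ℂ) (ρ R : ℝ), 0 < ρ → 4 * ρ < R → R ≤ 1 → Metric.closedBall x R ⊆ Ω → ∀ η : ℝ, 0 < η →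
        ∃ (k : ℕ) (δ₁ : ℝ), 0 < δ₁ ∧ ∀ δ ∈ Set.Ioc (0 : ℝ) δ₁, δ ≤ ρ →
          hexSAWLaw Ω δ (a δ) (b δ)
            {γ | (⟨γ.walk.toCurve fun v => (δ : ℂ) * hexCenter v⟩ : Curve ℂ).HasTraversals k x ρ R} ≤
            ENNReal.ofReal η) →
      (∀ (x : ℂ) (ρ R : ℝ), 0 < ρ → 4 * ρ < R → R ≤ 1 → x ∈ frontier Ω → ∀ η : ℝ, 0 < η →
        ∃ (k : ℕ) (δ₁ : ℝ), 0 < δ₁ ∧ ∀ δ ∈ Set.Ioc (0 : ℝ) δ₁, δ ≤ ρ →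
          hexSAWLaw Ω δ (a δ) (b δ)
            {γ | (⟨γ.walk.toCurve fun v => (δ : ℂ) * hexCenter v⟩ : Curve ℂ).HasTraversals k x ρ R} ≤
            ENNReal.ofReal η) →
      ∀ (x : ℂ) (ρ R : ℝ), 0 < ρ → 64 * ρ < R → R ≤ 1 → ¬ Metric.closedBall x R ⊆ Ω → ∀ η : ℝ, 0 < η →
        ∃ (k : ℕ) (δ₁ : ℝ), 0 < δ₁ ∧ ∀ δ ∈ Set.Ioc (0 : ℝ) δ₁, δ ≤ ρ →
          hexSAWLaw Ω δ (a δ) (b δ)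
            {γ | (⟨γ.walk.toCurve fun v => (δ : ℂ) * hexCenter v⟩ : Curve ℂ).HasTraversals k x ρ R} ≤
            ENNReal.ofReal η := by
  intro Ω hΩ a b hI hF x ρ R hρ hρR hR1 hbdry η hη
  -- the complement is closed and nonempty, `d = infDist x Ωᶜ ≤ R`
  have hCcl : IsClosed Ωᶜ := hΩ.isClosed_compl
  obtain ⟨z, hzR, hzΩ⟩ : ∃ z, z ∈ Metric.closedBall x R ∧ z ∉ Ω := Set.not_subset.1 hbdry
  have hCne : (Ωᶜ : Set ℂ).Nonempty := ⟨z, hzΩ⟩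
  obtain ⟨x', hx'Ω, hd⟩ := hCcl.exists_infDist_eq_dist hCne x
  -- `hd : infDist x Ωᶜ = dist x x'`
  have hdR : dist x x' ≤ R := by
    rw [← hd]
    exact (Metric.infDist_le_dist_of_mem (x := x) (Set.mem_compl hzΩ)).trans
      (by rwa [Metric.mem_closedBall, dist_comm] at hzR)
  have hball : ∀ y : ℂ, dist y x < dist x x' → y ∈ Ω := by
    intro y hy
    by_contra hyΩ
    have := Metric.infDist_le_dist_of_mem (x := x) (Set.mem_compl hyΩ)
    rw [hd] at this
    linarith [dist_comm x y]
  -- transfer of per-shell tightness along an inclusion of events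
  have transfer : ∀ (x₁ : ℂ) (ρ₁ R₁ : ℝ), ρ ≤ ρ₁ →
      (∀ (γ : Curve ℂ) (k : ℕ), γ.HasTraversals k x ρ R → γ.HasTraversals k x₁ ρ₁ R₁) →
      (∃ (k : ℕ) (δ₁ : ℝ), 0 < δ₁ ∧ ∀ δ ∈ Set.Ioc (0 : ℝ) δ₁, δ ≤ ρ₁ →
        hexSAWLaw Ω δ (a δ) (b δ)
          {γ | (⟨γ.walk.toCurve fun v => (δ : ℂ) * hexCenter v⟩ : Curve ℂ).HasTraversals k x₁ ρ₁ R₁} ≤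
          ENNReal.ofReal η) →
      ∃ (k : ℕ) (δ₁ : ℝ), 0 < δ₁ ∧ ∀ δ ∈ Set.Ioc (0 : ℝ) δ₁, δ ≤ ρ →
        hexSAWLaw Ω δ (a δ) (b δ)
          {γ | (⟨γ.walk.toCurve fun v => (δ : ℂ) * hexCenter v⟩ : Curve ℂ).HasTraversals k x ρ R} ≤
          ENNReal.ofReal η := by
    intro x₁ ρ₁ R₁ hρ₁ hmono ⟨k, δ₁, hδ₁, hk⟩
    exact ⟨k, δ₁, hδ₁, fun δ hδ hδρ =>
      (measure_mono fun γ hγ => hmono _ k hγ).trans (hk δ hδ (hδρ.trans hρ₁))⟩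
  by_cases hfar : 8 * ρ < dist x x'
  · -- interior thin shell `D(x; ρ, d/2)`
    have hsub : Metric.closedBall x (dist x x' / 2) ⊆ Ω := fun y hy => hball y (by
      rw [Metric.mem_closedBall] at hy; linarith [dist_nonneg (x := x) (y := x')])
    refine transfer x ρ (dist x x' / 2) le_rfl (fun γ k hγ => hγ.mono' le_rfl (by linarith)) ?_
    exact hI x ρ (dist x x' / 2) hρ (by linarith) (by linarith) hsub η hη
  · rw [not_lt] at hfar
    by_cases hdis : Disjoint (Metric.closedBall x ρ) (closure Ω)
    · -- the inner ball misses `closure Ω`: the event with threshold `1` is empty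
      refine ⟨1, ρ, hρ, fun δ hδ hδρ => ?_⟩
      have hempty : {γ : HexDomainSAW Ω δ (a δ) (b δ) |
          (⟨γ.walk.toCurve fun v => (δ : ℂ) * hexCenter v⟩ : Curve ℂ).HasTraversals 1 x ρ R} = ∅ :=
        Set.eq_empty_of_forall_notMem fun γ hγ =>
          not_hasTraversals_one_of_disjoint hdis (by linarith) γ hγ
      rw [hempty, measure_empty]
      exact bot_le
    · -- a frontier point `x''` within `10ρ`: the thin shell `D(x''; 11ρ, R - 10ρ)`
      obtain ⟨y, hyball, hycl⟩ := Set.not_disjoint_iff.1 hdis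
      rw [Metric.mem_closedBall] at hyball
      obtain ⟨x'', hx''fr, hx''d⟩ := exists_frontier_near hΩ hycl hyball hx'Ω hfar
      refine transfer x'' (11 * ρ) (R - 10 * ρ) (by linarith)
        (fun γ k hγ => hγ.mono (by linarith) (by linarith)) ?_
      exact hF x'' (11 * ρ) (R - 10 * ρ) (by linarith) (by linarith) (by linarith) hx''fr η hη

/-! ### (H1) and the crux from the interior atom and the on-frontier atom -/

/-- **(H1) from thin-interior and thin-on-frontier per-shell tightness.** For an open `Ω`: per-shell rate-free
tightness of the traversal number on thin interior shells and on thin shells centred on `frontier Ω` gives the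
all-shells traversal bound with `K = 64³`, `λ = 3 > 2`, `δ₀ = 1`. -/
theorem traversalBound_of_interiorThin_of_onFrontier {Ω : Set ℂ} (hΩ : IsOpen Ω) {a b : ℝ → HexVertex}
    (hI : ∀ (x : ℂ) (ρ R : ℝ), 0 < ρ → 4 * ρ < R → R ≤ 1 → Metric.closedBall x R ⊆ Ω → ∀ η : ℝ, 0 < η →
      ∃ (k : ℕ) (δ₁ : ℝ), 0 < δ₁ ∧ ∀ δ ∈ Set.Ioc (0 : ℝ) δ₁, δ ≤ ρ →
        hexSAWLaw Ω δ (a δ) (b δ)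
          {γ | (⟨γ.walk.toCurve fun v => (δ : ℂ) * hexCenter v⟩ : Curve ℂ).HasTraversals k x ρ R} ≤
          ENNReal.ofReal η)
    (hF : ∀ (x : ℂ) (ρ R : ℝ), 0 < ρ → 4 * ρ < R → R ≤ 1 → x ∈ frontier Ω → ∀ η : ℝ, 0 < η →
      ∃ (k : ℕ) (δ₁ : ℝ), 0 < δ₁ ∧ ∀ δ ∈ Set.Ioc (0 : ℝ) δ₁, δ ≤ ρ →
        hexSAWLaw Ω δ (a δ) (b δ)
          {γ | (⟨γ.walk.toCurve fun v => (δ : ℂ) * hexCenter v⟩ : Curve ℂ).HasTraversals k x ρ R} ≤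
          ENNReal.ofReal η) :
    ∃ (k : ℂ → ℝ → ℝ → ℕ) (K lam δ₀ : ℝ), 0 ≤ K ∧ 2 < lam ∧ 0 < δ₀ ∧
      ∀ δ ∈ Set.Ioc (0 : ℝ) δ₀, ∀ (x : ℂ) (ρ R : ℝ), δ ≤ ρ → ρ < R → R ≤ 1 →
        hexSAWLaw Ω δ (a δ) (b δ)
          {γ | (⟨γ.walk.toCurve fun v => (δ : ℂ) * hexCenter v⟩ : Curve ℂ).HasTraversals
            (k x ρ R) x ρ R} ≤ ENNReal.ofReal (K * (ρ / R) ^ lam) := by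
  -- interior shells, constant `4³`
  obtain ⟨k₁, hk₁⟩ := shellBound_of_perShellTight_thin 4 le_rfl (fun x R => Metric.closedBall x R ⊆ Ω) Ω a b
    (fun x ρ R hρ hρR hR1 hg η hη => hI x ρ R hρ hρR hR1 hg η hη) 3 (by norm_num)
  -- boundary shells, constant `64³`
  obtain ⟨k₂, hk₂⟩ := shellBound_of_perShellTight_thin 64 (by norm_num) (fun x R => ¬ Metric.closedBall x R ⊆ Ω)
    Ω a b (fun x ρ R hρ hρR hR1 hg η hη =>
      boundaryPerShellTight_of_onFrontier Ω hΩ a b hI hF x ρ R hρ hρR hR1 hg η hη) 3 (by norm_num)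
  refine ⟨fun x ρ R => max (k₁ x ρ R) (k₂ x ρ R), (64 : ℝ) ^ (3 : ℝ), 3, 1, by positivity, by norm_num, one_pos,
    fun δ hδ x ρ R hδρ hρR hR1 => ?_⟩
  have hρ : 0 < ρ := hδ.1.trans_le hδρ
  have ht0 : 0 ≤ ρ / R := (div_pos hρ (hρ.trans hρR)).le
  have h464 : (4 : ℝ) ^ (3 : ℝ) * (ρ / R) ^ (3 : ℝ) ≤ (64 : ℝ) ^ (3 : ℝ) * (ρ / R) ^ (3 : ℝ) :=
    mul_le_mul_of_nonneg_right (Real.rpow_le_rpow (by norm_num) (by norm_num) (by norm_num))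
      (Real.rpow_nonneg ht0 _)
  by_cases hin : Metric.closedBall x R ⊆ Ω
  · calc hexSAWLaw Ω δ (a δ) (b δ) _
        ≤ hexSAWLaw Ω δ (a δ) (b δ)
            {γ | (⟨γ.walk.toCurve fun v => (δ : ℂ) * hexCenter v⟩ : Curve ℂ).HasTraversals (k₁ x ρ R) x ρ R} :=
          measure_mono fun γ hγ => Curve.HasTraversals.of_le hγ (le_max_left _ _)
      _ ≤ ENNReal.ofReal ((4 : ℝ) ^ (3 : ℝ) * (ρ / R) ^ (3 : ℝ)) := hk₁ δ x ρ R hδ.1 hδρ hρR hR1 hin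
      _ ≤ ENNReal.ofReal ((64 : ℝ) ^ (3 : ℝ) * (ρ / R) ^ (3 : ℝ)) := ENNReal.ofReal_le_ofReal h464
  · calc hexSAWLaw Ω δ (a δ) (b δ) _
        ≤ hexSAWLaw Ω δ (a δ) (b δ)
            {γ | (⟨γ.walk.toCurve fun v => (δ : ℂ) * hexCenter v⟩ : Curve ℂ).HasTraversals (k₂ x ρ R) x ρ R} :=
          measure_mono fun γ hγ => Curve.HasTraversals.of_le hγ (le_max_right _ _)
      _ ≤ ENNReal.ofReal ((64 : ℝ) ^ (3 : ℝ) * (ρ / R) ^ (3 : ℝ)) := hk₂ δ x ρ R hδ.1 hδρ hρR hR1 hin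

/-- **`HexTight` from the interior atom and the ON-FRONTIER atom, per-shell forms.** If for every Dobrushin domain and
hexagonal endpoint approximation the number of separate shell traversals of the critical SAW polyline is tight as
`δ → 0` (i) on every thin interior shell and (ii) on every thin shell centred at a point of the Jordan curve
`frontier D.carrier`, then the critical hexagonal SAW laws are eventually tight. -/
theorem hexTight_of_interiorThin_of_onFrontier
    (hI : ∀ (D : DobrushinDomain) (a b : ℝ → HexVertex), IsEmbEndpointApprox hexGraph hexCenter D a b →
      ∀ (x : ℂ) (ρ R : ℝ), 0 < ρ → 4 * ρ < R → R ≤ 1 → Metric.closedBall x R ⊆ D.carrier → ∀ η : ℝ, 0 < η →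
        ∃ (k : ℕ) (δ₁ : ℝ), 0 < δ₁ ∧ ∀ δ ∈ Set.Ioc (0 : ℝ) δ₁, δ ≤ ρ →
          hexSAWLaw D.carrier δ (a δ) (b δ)
            {γ | (⟨γ.walk.toCurve fun v => (δ : ℂ) * hexCenter v⟩ : Curve ℂ).HasTraversals k x ρ R} ≤
            ENNReal.ofReal η)
    (hF : ∀ (D : DobrushinDomain) (a b : ℝ → HexVertex), IsEmbEndpointApprox hexGraph hexCenter D a b →
      ∀ (x : ℂ) (ρ R : ℝ), 0 < ρ → 4 * ρ < R → R ≤ 1 → x ∈ frontier D.carrier → ∀ η : ℝ, 0 < η →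
        ∃ (k : ℕ) (δ₁ : ℝ), 0 < δ₁ ∧ ∀ δ ∈ Set.Ioc (0 : ℝ) δ₁, δ ≤ ρ →
          hexSAWLaw D.carrier δ (a δ) (b δ)
            {γ | (⟨γ.walk.toCurve fun v => (δ : ℂ) * hexCenter v⟩ : Curve ℂ).HasTraversals k x ρ R} ≤
            ENNReal.ofReal η) :
    Summit.CriticalPhenomena.SAWScalingLimit.Theses.SAWDevelopingMap.HexTight := by
  refine HexConjecture.MarginalWedge.stub_hexTight_of_traversalBound fun D a b hab => ?_
  exact traversalBound_of_interiorThin_of_onFrontier D.isOpen (hI D a b hab) (hF D a b hab)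

/-- **The assembled reduction for the skeleton owner**: an INTERIOR traversal bound with some exponent `> 1` per
`(D, a, b)` (e.g. `Reversal.stub_virginizationTight`'s output, `λ = 3`, fed by the pinch bound) together with per-shell
tightness of the traversal number on thin shells centred ON the Jordan curve gives the crux `HexTight`
(`ExponentBootstrap.interiorPerShellTight_of_interiorBound_one`, `hexTight_of_interiorThin_of_onFrontier`). -/
theorem hexTight_of_interiorBound_one_of_onFrontier
    (hI : ∀ (D : DobrushinDomain) (a b : ℝ → HexVertex), IsEmbEndpointApprox hexGraph hexCenter D a b →
      ∃ (k : ℂ → ℝ → ℝ → ℕ) (K lam δ₀ : ℝ), 0 ≤ K ∧ 1 < lam ∧ 0 < δ₀ ∧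
        ∀ δ ∈ Set.Ioc (0 : ℝ) δ₀, ∀ (x : ℂ) (ρ R : ℝ), δ ≤ ρ → ρ < R → R ≤ 1 →
          Metric.closedBall x R ⊆ D.carrier →
          hexSAWLaw D.carrier δ (a δ) (b δ)
            {γ | (⟨γ.walk.toCurve fun v => (δ : ℂ) * hexCenter v⟩ : Curve ℂ).HasTraversals
              (k x ρ R) x ρ R} ≤ ENNReal.ofReal (K * (ρ / R) ^ lam))
    (hF : ∀ (D : DobrushinDomain) (a b : ℝ → HexVertex), IsEmbEndpointApprox hexGraph hexCenter D a b →
      ∀ (x : ℂ) (ρ R : ℝ), 0 < ρ → 4 * ρ < R → R ≤ 1 → x ∈ frontier D.carrier → ∀ η : ℝ, 0 < η →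
        ∃ (k : ℕ) (δ₁ : ℝ), 0 < δ₁ ∧ ∀ δ ∈ Set.Ioc (0 : ℝ) δ₁, δ ≤ ρ →
          hexSAWLaw D.carrier δ (a δ) (b δ)
            {γ | (⟨γ.walk.toCurve fun v => (δ : ℂ) * hexCenter v⟩ : Curve ℂ).HasTraversals k x ρ R} ≤
            ENNReal.ofReal η) :
    Summit.CriticalPhenomena.SAWScalingLimit.Theses.SAWDevelopingMap.HexTight :=
  hexTight_of_interiorThin_of_onFrontier
    (fun D a b hab => interiorPerShellTight_of_interiorBound_one D.carrier a b (hI D a b hab)) hF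

end Summit.CriticalPhenomena.SAWScalingLimit.Theorems.HexTight.BoundaryOnFrontier

end
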